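import Literature.Computability.Cryptography.TM2ToWordRAMRun
import HarnessLib

/-!
# Multi-stack Turing machines on the word RAM, III: bundled machines, the loader, whole runs

Continuation of `TM2ToWordRAM.lean` / `TM2ToWordRAMRun.lean`. For a bundled machine
`tm : Turing.FinTM2` (finitely many stacks, labels and internal states; finite input alphabet)
this file provides

* `TM2Emu.alphabet tm k` — the *working alphabet* of stack `k`: the effective alphabet
  `TM2Sim.IsSym` of `Literature.Computability.Complexity.TM2Window` (input symbols on the input
  stack, and every symbol pushable by the program; finite by `TM2Sim.finite_isSym`, enumerated as
  `TM2Emu.alphaList`); `TM2Emu.enc tm` — the numbering of stacks, symbols, labels and states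
  (`Enc`), with `TM2Emu.enc_good`;
* `ptrInit`, `loader` — word-RAM code initialising the pointer table of the empty stacks and
  pushing an input code list (stored below the base `Q`) onto the input stack; `ptrInit_exec`,
  `loader_exec`;
* `TM2Emu.simProgram tm` and **`TM2Emu.simProgram_exec`**: if `tm` outputs `out` on input `inp`
  within `T` steps (`Turing.TM2OutputsInTime`), then from a memory holding the codes of `inp`
  below `Q` (and `0` from `Q` on) the program reaches the memory of the halting configuration
  `Turing.haltList tm out` within `bootCost + 9 |inp| + T · (stepCost + 2)` word-RAM steps — the
  simulation of multi-stack Turing machines by word RAMs with constant overhead per step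
  (folklore; Papadimitriou 1994, §2.6; Cook–Reckhow 1973, §2), for word sizes in which the
  addresses of the simulation fit (`cellAddr Q κ κ (|inp| + T · machinePushBound) < 2 ^ w`).

## References

* C. H. Papadimitriou, *Computational Complexity*, Addison-Wesley 1994, §2.6.
* S. A. Cook, R. A. Reckhow, *Time bounded random access machines*, JCSS 7 (1973), §2.
* V. Vassilevska Williams, *On some fine-grained questions in algorithms and complexity*,
  Proc. ICM 2018, §2.
-/

namespace Literature.Computability.Cryptography.WordRAM

open StateTransition Turing

-- The finiteness fields of a bundled `FinTM2` are instance-implicit structure fields, not global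
-- instances (Mathlib registers only `decidableEqK`/`inhabitedσ`); they are made available locally,
-- exactly as `letI := tm.ΛFin` does in `TM2Window.lean`/`TimeBoundsProofs.lean`. No library
-- instance is overridden (the carriers `tm.K`, `tm.Λ`, `tm.σ`, `tm.Γ tm.k₀` have no other instances).
attribute [local instance] Turing.FinTM2.kFin Turing.FinTM2.ΛFin Turing.FinTM2.σFin
  Turing.FinTM2.Γk₀Fin

namespace TM2Emu

variable (tm : FinTM2)

/-! ## The working alphabet and the numbering of a bundled machine -/

/-- **The working alphabet** of stack `k`: the effective alphabet `TM2Sim.IsSym tm k` of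
`TM2Window.lean` (the input alphabet on the input stack, and every symbol pushable by a statement
of the program), as a family of sets. [folklore] -/
def alphabet : ∀ k, Set (tm.Γ k) := fun k => {a | Complexity.TM2Sim.IsSym tm k a}

/-- An enumeration of the (finite, `TM2Sim.finite_isSym`) working alphabet of stack `k`. [folklore] -/
noncomputable def alphaList (k : tm.K) : List (tm.Γ k) :=
  (Complexity.TM2Sim.finite_isSym tm k).toFinset.toList

/-- `alphaList` enumerates `alphabet`. [folklore] -/
theorem mem_alphaList_iff {k : tm.K} {a : tm.Γ k} : a ∈ alphaList tm k ↔ a ∈ alphabet tm k := by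
  simp [alphaList, alphabet]

open scoped Classical in
/-- **The numbering of a bundled machine**: stacks, labels and states by `Fintype.equivFin`
(labels shifted by one), symbols by their position in the working alphabet (shifted by one).
[folklore] -/
noncomputable def enc : Enc tm.K tm.Γ tm.Λ tm.σ where
  κ := Fintype.card tm.K
  ι := fun k => Fintype.equivFin tm.K k
  ιinv := fun i => if h : i < Fintype.card tm.K then some ((Fintype.equivFin tm.K).symm ⟨i, h⟩)
    else none
  γ := (Finset.univ : Finset tm.K).sup fun k => (alphaList tm k).length
  code := fun k a => (alphaList tm k).idxOf a + 1
  decode := fun k c => if c = 0 then none else (alphaList tm k)[c - 1]?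
  lab := fun l => Fintype.equivFin tm.Λ l + 1
  sBase := Fintype.card tm.σ
  st := fun v => Fintype.equivFin tm.σ v

/-- The dispatch keys of `enc tm` are below `keyBound tm`. [folklore] -/
def keyBound : ℕ := (Fintype.card tm.Λ + 1) * Fintype.card tm.σ

/-- The numbering of a bundled machine is good for its working alphabet. [folklore] -/
theorem enc_good : (enc tm).Good (alphabet tm) := by
  classical
  refine
    { κ_pos := Fintype.card_pos_iff.2 ⟨tm.k₀⟩
      ι_lt := fun k => (Fintype.equivFin tm.K k).is_lt
      ιinv_iff := ?_
      code_pos := fun k a _ => Nat.succ_pos _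
      code_le := ?_
      decode_code := ?_
      decode_zero := fun k => by simp [enc]
      lab_pos := fun l => Nat.succ_pos _
      lab_inj := fun l l' h => (Fintype.equivFin tm.Λ).injective (Fin.ext (by simpa [enc] using h))
      sBase_pos := Fintype.card_pos_iff.2 ⟨tm.initialState⟩
      st_lt := fun v => (Fintype.equivFin tm.σ v).is_lt
      st_inj := fun v v' h => (Fintype.equivFin tm.σ).injective (Fin.ext (by simpa [enc] using h)) }
  · intro i k
    simp only [enc]
    by_cases hi : i < Fintype.card tm.K
    · rw [dif_pos hi, Option.some.injEq, Equiv.symm_apply_eq, Fin.ext_iff, Fin.val_mk, eq_comm]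
    · rw [dif_neg hi]
      simp only [reduceCtorEq, false_iff]
      intro h
      exact hi (h ▸ (Fintype.equivFin tm.K k).is_lt)
  · intro k a ha
    rw [← mem_alphaList_iff] at ha
    have hlt : (alphaList tm k).idxOf a < (alphaList tm k).length := List.idxOf_lt_length_iff.2 ha
    have hle : (alphaList tm k).length ≤ (enc tm).γ :=
      Finset.le_sup (f := fun k => (alphaList tm k).length) (Finset.mem_univ k)
    show (alphaList tm k).idxOf a + 1 ≤ (enc tm).γ
    omega
  · intro k a ha
    rw [← mem_alphaList_iff] at ha
    have hlt : (alphaList tm k).idxOf a < (alphaList tm k).length := List.idxOf_lt_length_iff.2 ha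
    simp only [enc, Nat.add_one_ne_zero, if_false, Nat.add_sub_cancel]
    rw [List.getElem?_eq_getElem hlt, List.getElem_idxOf hlt]

/-- Label codes are at most the number of labels. [folklore] -/
theorem lab_le (l : tm.Λ) : (enc tm).lab l ≤ Fintype.card tm.Λ :=
  (Fintype.equivFin tm.Λ l).is_lt

/-- Codes separate a symbol of the working alphabet from every other symbol (symbols outside the
alphabet all receive the code `|alphaList| + 1`). [folklore] -/
theorem code_eq_code_iff {k : tm.K} {a a' : tm.Γ k} (ha : a ∈ alphabet tm k) :
    (enc tm).code k a' = (enc tm).code k a ↔ a' = a := by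
  classical
  rw [← mem_alphaList_iff] at ha
  refine ⟨fun h => ?_, fun h => by rw [h]⟩
  have h' : (alphaList tm k).idxOf a' = (alphaList tm k).idxOf a := by simpa [enc] using h
  have hlt : (alphaList tm k).idxOf a < (alphaList tm k).length := List.idxOf_lt_length_iff.2 ha
  by_cases ha' : a' ∈ alphaList tm k
  · exact (List.idxOf_inj ha').1 h'
  · rw [List.idxOf_eq_length_iff.2 ha'] at h'
    omega

/-- The program pushes only symbols of the working alphabet. [folklore] -/
theorem pushesSym_alphabet (l : tm.Λ) (k : tm.K) (a : tm.Γ k)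
    (h : Complexity.TM2Sim.PushesSym (tm.m l) k a) : a ∈ alphabet tm k :=
  Or.inl ⟨l, h⟩

/-- Input symbols lie in the working alphabet of the input stack. [folklore] -/
theorem mem_alphabet_k₀ (a : tm.Γ tm.k₀) : a ∈ alphabet tm tm.k₀ := Or.inr rfl

/-- The stacks of the initial configuration lie in the working alphabet
(`TM2Sim.good_initList`). [folklore] -/
theorem initList_mem (inp : List (tm.Γ tm.k₀)) :
    ∀ k, ∀ a ∈ (initList tm inp).stk k, a ∈ alphabet tm k :=
  Complexity.TM2Sim.good_initList tm inp

/-- The code lists of the empty stack assignment are empty. [folklore] -/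
theorem stk_empty : (enc tm).stk (fun _ => ([] : List (tm.Γ _))) = fun _ => [] := by
  funext i
  unfold Enc.stk
  cases (enc tm).ιinv i <;> rfl

/-- The code lists of the initial configuration: the input codes on the input stack. [folklore] -/
theorem stk_initList (inp : List (tm.Γ tm.k₀)) :
    (enc tm).stk (initList tm inp).stk =
      Function.update (fun _ => []) ((enc tm).ι tm.k₀) (inp.map ((enc tm).code tm.k₀)) := by
  rw [Complexity.TM2Comp.initList_eq]
  dsimp only
  rw [Enc.stk_update (enc_good tm), stk_empty]

/-- The code lists of the halting configuration: the output codes on the output stack. [folklore] -/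
theorem stk_haltList (out : List (tm.Γ tm.k₁)) :
    (enc tm).stk (haltList tm out).stk =
      Function.update (fun _ => []) ((enc tm).ι tm.k₁) (out.map ((enc tm).code tm.k₁)) := by
  rw [Complexity.TM2Comp.haltList_eq]
  dsimp only
  rw [Enc.stk_update (enc_good tm), stk_empty]

end TM2Emu

/-! ## Booting: the pointer table of the empty stacks, and the loader -/

namespace SProg

/-- The body of the pointer-table initialisation: `r8 -= 1; r5 := Q + r8; r6 := r5 + κ; mem[r5] := r6`. [folklore] -/
def ptrInitBody (κ : ℕ) : List OpSpec :=
  [(.sub, .dir 8, .dir 8, .imm 1), (.add, .dir 5, .dir 4, .dir 8), (.add, .dir 6, .dir 5, .imm κ),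
    (.add, .ind 5, .dir 6, .imm 0)]

/-- Initialise the pointer table of `κ` empty stacks: `r8 := κ; while r8 ≠ 0 { ptrInitBody }`. [folklore] -/
def ptrInit (κ : ℕ) : SProg :=
  .seq (.op .add (.dir 8) (.imm κ) (.imm 0)) (.whilenz (.dir 8) (.block (ptrInitBody κ)))

/-- `ptrInit` makes no oracle query. [folklore] -/
theorem ptrInit_queryFree (κ : ℕ) : (ptrInit κ).QueryFree := ⟨trivial, block_queryFree _⟩

/-- The data memory during the pointer-table initialisation: pointers `m, …, κ - 1` written. [folklore] -/
def ptrMem (H : ℕ → ℕ) (Q κ m : ℕ) : ℕ → ℕ := fun a =>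
  if Q + m ≤ a ∧ a < Q + κ then Q + κ + (a - Q) else H a

/-- Before the loop nothing is written. [folklore] -/
theorem ptrMem_self (H : ℕ → ℕ) (Q κ : ℕ) : ptrMem H Q κ κ = H := by
  funext a; simp [ptrMem]

/-- One more pointer. [folklore] -/
theorem ptrMem_pred (H : ℕ → ℕ) (Q κ : ℕ) {m : ℕ} (hm : 1 ≤ m) (hmκ : m ≤ κ) :
    Function.update (ptrMem H Q κ m) (Q + (m - 1)) (Q + (m - 1) + κ) = ptrMem H Q κ (m - 1) := by
  funext a
  by_cases ha : a = Q + (m - 1)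
  · subst ha
    rw [Function.update_self]
    unfold ptrMem
    rw [if_pos ⟨le_rfl, by omega⟩]
    omega
  · rw [Function.update_of_ne ha]
    unfold ptrMem
    by_cases h1 : Q + m ≤ a ∧ a < Q + κ
    · rw [if_pos h1, if_pos ⟨by omega, h1.2⟩]
    · rw [if_neg h1, if_neg (by omega)]

/-- After the loop the data memory is that of `κ` empty stacks (if it was `0` above the table). [folklore] -/
theorem ptrMem_zero {H : ℕ → ℕ} {Q κ : ℕ} (hH : ∀ a, Q + κ ≤ a → H a = 0) :
    ptrMem H Q κ 0 = dataMem H Q κ (fun _ => []) := by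
  funext a
  unfold ptrMem dataMem
  by_cases h1 : a < Q
  · rw [if_neg (by omega), if_pos h1]
  by_cases h2 : a < Q + κ
  · rw [if_pos ⟨by omega, h2⟩, if_neg h1, if_pos h2]
    unfold cellAddr; simp
  · rw [if_neg (by omega), if_neg h1, if_neg h2, stackCell_nil, hH a (by omega)]

section boot

variable {w : ℕ} {O : List ℕ → List ℕ}

/-- One iteration of the pointer-table initialisation. [folklore] -/
theorem ptrInitBody_exec {R H : ℕ → ℕ} {Q κ m : ℕ} (h4 : R 4 = Q) (h8 : R 8 = m) (hQ : 100 ≤ Q)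
    (hm : 1 ≤ m) (hmκ : m ≤ κ) (hw : Q + κ + κ < 2 ^ w) (qs : List (List ℕ)) :
    Exec w O (block (ptrInitBody κ)) ⟨merge R (ptrMem H Q κ m), qs⟩
      ⟨merge (Function.update (Function.update (Function.update R 8 (m - 1)) 5 (Q + (m - 1))) 6
        (Q + (m - 1) + κ)) (ptrMem H Q κ (m - 1)), qs⟩ 4 := by
  have key : ∀ Rf, execOps w (merge R (ptrMem H Q κ m)) (ptrInitBody κ) = Rf →
      Rf = merge (Function.update (Function.update (Function.update R 8 (m - 1)) 5 (Q + (m - 1))) 6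
        (Q + (m - 1) + κ)) (Function.update (ptrMem H Q κ m) (Q + (m - 1)) (Q + (m - 1) + κ)) := by
    intro Rf hR
    unfold ptrInitBody at hR
    have htmp := execOps_cons_fwd hR; clear hR; obtain ⟨v1, hv1, hR⟩ := htmp
    simp -failIfUnchanged (disch := omega) only [Operand.write, Operand.read, merge_apply_of_lt,
      update_merge_of_lt,
      BinOp.eval_sub_of_le, h8]
      at hv1 hR
    have htmp := execOps_cons_fwd hR; clear hR; obtain ⟨v2, hv2, hR⟩ := htmp
    simp -failIfUnchanged (disch := omega) only [Operand.write, Operand.read, merge_apply_of_lt,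
      Function.update_self, Function.update_of_ne, update_merge_of_lt,
      BinOp.eval_add_of_lt, h4,
      ← hv1] at hv2 hR
    have htmp := execOps_cons_fwd hR; clear hR; obtain ⟨v3, hv3, hR⟩ := htmp
    simp -failIfUnchanged (disch := omega) only [Operand.write, Operand.read, merge_apply_of_lt,
      Function.update_self, update_merge_of_lt,
      BinOp.eval_add_of_lt,
      ← hv2] at hv3 hR
    have htmp := execOps_cons_fwd hR; clear hR; obtain ⟨v4, hv4, hR⟩ := htmp
    simp -failIfUnchanged (disch := omega) only [Operand.write, Operand.read, merge_apply_of_lt,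
      Function.update_self, Function.update_of_ne,
      update_merge_of_le, Nat.add_zero, BinOp.eval_add_of_lt,
      ← hv3] at hv4 hR
    simp only [execOps_nil] at hR; subst hR
    subst hv1 hv2 hv3 hv4
    rfl
  have hfin := key _ rfl
  rw [ptrMem_pred H Q κ hm hmκ] at hfin
  exact Exec.block' _ qs hfin

/-- **Semantics of `ptrInit`.** On a data memory that is `0` above the pointer table, `ptrInit`
produces the memory of `κ` empty stacks within `6 κ + 2` steps, keeping all registers but
`5, 6, 8`. [folklore] -/
theorem ptrInit_exec {R H : ℕ → ℕ} {Q κ : ℕ} (h4 : R 4 = Q) (hQ : 100 ≤ Q)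
    (hH : ∀ a, Q + κ ≤ a → H a = 0) (hκ : κ < 2 ^ w) (hw : Q + κ + κ < 2 ^ w) (qs : List (List ℕ)) :
    ∃ R' : ℕ → ℕ, ExecLE w O (ptrInit κ) ⟨merge R H, qs⟩ ⟨merge R' (dataMem H Q κ fun _ => []), qs⟩
      (κ * 6 + 2) ∧ ∀ a, a ≠ 5 → a ≠ 6 → a ≠ 8 → R' a = R a := by
  set Inv : ℕ → Store → Prop := fun j st => ∃ R' : ℕ → ℕ,
    st = ⟨merge R' (ptrMem H Q κ (κ - j)), qs⟩ ∧ R' 4 = Q ∧ R' 8 = κ - j ∧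
      ∀ a, a ≠ 5 → a ≠ 6 → a ≠ 8 → R' a = R a with hInv
  have hset : Exec w O (.op .add (.dir 8) (.imm κ) (.imm 0)) ⟨merge R H, qs⟩
      ⟨merge (Function.update R 8 κ) H, qs⟩ 1 :=
    Exec.op_dir' (by decide) (by simp [BinOp.eval_add_of_lt (show κ + 0 < 2 ^ w by omega)])
  have hbody : ∀ j, j < κ → ∀ st, Inv j st → (Operand.dir 8).read st.mem ≠ 0 ∧
      ∃ st', ExecLE w O (.block (ptrInitBody κ)) st st' 4 ∧ Inv (j + 1) st' := by
    intro j hj st hst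
    obtain ⟨R', rfl, h4', h8', hR'⟩ := hst
    refine ⟨by simp [Operand.read_dir_merge (show 8 < 100 by decide), h8']; omega, ?_⟩
    refine ⟨_, (ptrInitBody_exec (H := H) h4' h8' hQ (by omega) (by omega) hw qs).execLE, ?_⟩
    refine ⟨_, by rw [show κ - (j + 1) = κ - j - 1 by omega], by simp [h4'], by simp; omega, ?_⟩
    intro a h5 h6 h8
    simp [h5, h6, h8, hR' a h5 h6 h8]
  have hexit : ∀ st, Inv κ st → (Operand.dir 8).read st.mem = 0 := by
    intro st hst
    obtain ⟨R', rfl, -, h8', -⟩ := hst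
    simp [Operand.read_dir_merge (show 8 < 100 by decide), h8']
  have h0 : Inv 0 ⟨merge (Function.update R 8 κ) H, qs⟩ :=
    ⟨_, by rw [Nat.sub_zero, ptrMem_self], by simp [h4], by simp, fun a _ _ h8 => by simp [h8]⟩
  obtain ⟨st', hloop, R', rfl, -, -, hR'⟩ := ExecLE.whilenz_invariant κ 4 Inv hbody hexit h0
  rw [Nat.sub_self, ptrMem_zero hH] at hloop
  refine ⟨R', ?_, hR'⟩
  have := hset.execLE.seq hloop
  exact this.mono (by omega)

/-- The body of the loader: `r11 -= 1; r5 := Q + i₀; r6 := mem[r5]; r6 += κ; mem[r5] := r6;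
mem[r6] := mem[r11]; r10 -= 1` — push the code at the decremented source pointer on stack `i₀`.
[folklore] -/
def loadBody (κ i₀ : ℕ) : List OpSpec :=
  [(.sub, .dir 11, .dir 11, .imm 1), (.add, .dir 5, .dir 4, .imm i₀), (.add, .dir 6, .ind 5, .imm 0),
    (.add, .dir 6, .dir 6, .imm κ), (.add, .ind 5, .dir 6, .imm 0), (.add, .ind 6, .ind 11, .imm 0),
    (.sub, .dir 10, .dir 10, .imm 1)]

/-- **The loader**: push the `r10` codes stored below address `r11`, last first, on stack `i₀`
(so that the first code ends on top, as in `Turing.initList`). [folklore] -/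
def loader (κ i₀ : ℕ) : SProg :=
  .whilenz (.dir 10) (.block (loadBody κ i₀))

/-- The loader makes no oracle query. [folklore] -/
theorem loader_queryFree (κ i₀ : ℕ) : (loader κ i₀).QueryFree := block_queryFree _

/-- One iteration of the loader. [folklore] -/
theorem loadBody_exec {R G : ℕ → ℕ} {Q κ i₀ s m n : ℕ} {x : List ℕ} (h4 : R 4 = Q) (h10 : R 10 = m)
    (h11 : R 11 = s + m) (hQ : 100 ≤ Q) (hs : 100 ≤ s) (hsn : s + n ≤ Q) (hi : i₀ < κ)
    (hx : x.length = n) (hm : 1 ≤ m) (hmn : m ≤ n)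
    (hG : ∀ t, (ht : t < n) → G (s + t) = x[t]'(hx ▸ ht)) (hxw : ∀ c ∈ x, c < 2 ^ w)
    (hw : cellAddr Q κ κ n < 2 ^ w) (qs : List (List ℕ)) :
    Exec w O (block (loadBody κ i₀))
      ⟨merge R (dataMem G Q κ (Function.update (fun _ => []) i₀ (x.drop m))), qs⟩
      ⟨merge (Function.update (Function.update (Function.update (Function.update R 11
          (s + m - 1)) 5 (Q + i₀)) 6 (cellAddr Q κ i₀ (n - m + 1))) 10 (m - 1))
        (dataMem G Q κ (Function.update (fun _ => []) i₀ (x.drop (m - 1)))), qs⟩ 7 := by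
  set S : ℕ → List ℕ := Function.update (fun _ => []) i₀ (x.drop m) with hS
  have hSi : S i₀ = x.drop m := by simp [hS]
  have hlen : (S i₀).length = n - m := by rw [hSi, List.length_drop, hx]
  set p : ℕ := cellAddr Q κ i₀ (n - m) with hp
  have hp1 : cellAddr Q κ i₀ (n - m + 1) = p + κ := cellAddr_succ Q κ i₀ _
  have hpQ : Q + κ ≤ p := le_cellAddr Q κ i₀ _
  have hpw : p + κ < 2 ^ w := by
    rw [← hp1]; exact (Enc.cellAddr_lt_cellAddr hi (by omega)).trans hw
  have hptr : dataMem G Q κ S (Q + i₀) = p := by rw [dataMem_ptr G Q S hi, hlen]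
  have hlt : m - 1 < x.length := by omega
  set c : ℕ := x[m - 1] with hc
  have hcw : c < 2 ^ w := hxw _ (List.getElem_mem hlt)
  have hsrc : dataMem G Q κ S (s + m - 1) = c := by
    rw [dataMem_of_lt G κ S (show s + m - 1 < Q by omega), show s + m - 1 = s + (m - 1) by omega,
      hG (m - 1) (by omega)]
  have key : ∀ Rf, execOps w (merge R (dataMem G Q κ S)) (loadBody κ i₀) = Rf →
      Rf = merge (Function.update (Function.update (Function.update (Function.update R 11
          (s + m - 1)) 5 (Q + i₀)) 6 (p + κ)) 10 (m - 1))
        (Function.update (Function.update (dataMem G Q κ S) (Q + i₀) (p + κ)) (p + κ) c) := by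
    intro Rf hR
    unfold loadBody at hR
    have htmp := execOps_cons_fwd hR; clear hR; obtain ⟨v1, hv1, hR⟩ := htmp
    simp -failIfUnchanged (disch := omega) only [Operand.write, Operand.read, merge_apply_of_lt,
      update_merge_of_lt,
      BinOp.eval_sub_of_le, h11
      ] at hv1 hR
    have htmp := execOps_cons_fwd hR; clear hR; obtain ⟨v2, hv2, hR⟩ := htmp
    simp -failIfUnchanged (disch := omega) only [Operand.write, Operand.read, merge_apply_of_lt,
      Function.update_of_ne, update_merge_of_lt,
      BinOp.eval_add_of_lt, h4,
      ← hv1] at hv2 hR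
    have htmp := execOps_cons_fwd hR; clear hR; obtain ⟨v3, hv3, hR⟩ := htmp
    simp -failIfUnchanged (disch := omega) only [Operand.write, Operand.read, merge_apply_of_lt,
      merge_apply_of_le, Function.update_self, update_merge_of_lt,
      Nat.add_zero, BinOp.eval_add_of_lt,
      hptr, ← hv2] at hv3 hR
    have htmp := execOps_cons_fwd hR; clear hR; obtain ⟨v4, hv4, hR⟩ := htmp
    simp -failIfUnchanged (disch := omega) only [Operand.write, Operand.read, merge_apply_of_lt,
      Function.update_self, update_merge_of_lt,
      BinOp.eval_add_of_lt,
      ← hv3] at hv4 hR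
    have htmp := execOps_cons_fwd hR; clear hR; obtain ⟨v5, hv5, hR⟩ := htmp
    simp -failIfUnchanged (disch := omega) only [Operand.write, Operand.read, merge_apply_of_lt,
      Function.update_self, Function.update_of_ne,
      update_merge_of_le, Nat.add_zero, BinOp.eval_add_of_lt,
      ← hv4] at hv5 hR
    have htmp := execOps_cons_fwd hR; clear hR; obtain ⟨v6, hv6, hR⟩ := htmp
    simp -failIfUnchanged (disch := omega) only [Operand.write, Operand.read, merge_apply_of_lt,
      merge_apply_of_le, Function.update_self, Function.update_of_ne,
      update_merge_of_le, Nat.add_zero, BinOp.eval_add_of_lt,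
      hsrc, ← hv5] at hv6 hR
    have htmp := execOps_cons_fwd hR; clear hR; obtain ⟨v7, hv7, hR⟩ := htmp
    simp -failIfUnchanged (disch := omega) only [Operand.write, Operand.read, merge_apply_of_lt,
      Function.update_of_ne, update_merge_of_lt,
      BinOp.eval_sub_of_le, h10,
      ← hv6] at hv7 hR
    simp only [execOps_nil] at hR; subst hR
    subst hv1 hv2 hv3 hv4 hv5 hv6 hv7
    rw [Function.update_idem]
  have hfin := key _ rfl
  have hpush := dataMem_push G Q hi S c
  rw [hlen, hp1, hSi] at hpush
  rw [hpush] at hfin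
  have hdrop : Function.update S i₀ (c :: x.drop m) =
      Function.update (fun _ => []) i₀ (x.drop (m - 1)) := by
    have h := List.drop_eq_getElem_cons hlt
    rw [Nat.sub_add_cancel hm] at h
    rw [hS, Function.update_idem, hc, ← h]
  rw [hdrop] at hfin
  rw [hp1]
  exact Exec.block' _ qs hfin

/-- **Semantics of the loader.** With `Q` in register `4`, the count `n` in register `10` and the
address `s + n` past the source in register `11`, where the data addresses `[s, s + n)` below `Q`
hold the code list `x`, the loader turns the memory of empty stacks into the memory with `x`
(first code on top) on stack `i₀`, within `9 n + 1` steps. [folklore] -/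
theorem loader_exec {R G : ℕ → ℕ} {Q κ i₀ s n : ℕ} {x : List ℕ} (h4 : R 4 = Q) (h10 : R 10 = n)
    (h11 : R 11 = s + n) (hQ : 100 ≤ Q) (hs : 100 ≤ s) (hsn : s + n ≤ Q) (hi : i₀ < κ)
    (hx : x.length = n) (hG : ∀ t, (ht : t < n) → G (s + t) = x[t]'(hx ▸ ht))
    (hxw : ∀ c ∈ x, c < 2 ^ w) (hw : cellAddr Q κ κ n < 2 ^ w) (qs : List (List ℕ)) :
    ∃ R' : ℕ → ℕ, ExecLE w O (loader κ i₀) ⟨merge R (dataMem G Q κ fun _ => []), qs⟩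
      ⟨merge R' (dataMem G Q κ (Function.update (fun _ => []) i₀ x)), qs⟩ (n * 9 + 1) ∧
      R' 4 = Q := by
  set Inv : ℕ → Store → Prop := fun j st => ∃ R' : ℕ → ℕ,
    st = ⟨merge R' (dataMem G Q κ (Function.update (fun _ => []) i₀ (x.drop (n - j)))), qs⟩ ∧
      R' 4 = Q ∧ R' 10 = n - j ∧ R' 11 = s + (n - j) with hInv
  have hbody : ∀ j, j < n → ∀ st, Inv j st → (Operand.dir 10).read st.mem ≠ 0 ∧
      ∃ st', ExecLE w O (.block (loadBody κ i₀)) st st' 7 ∧ Inv (j + 1) st' := by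
    intro j hj st hst
    obtain ⟨R', rfl, h4', h10', h11'⟩ := hst
    refine ⟨by simp [Operand.read_dir_merge (show 10 < 100 by decide), h10']; omega, ?_⟩
    refine ⟨_, (loadBody_exec (O := O) h4' h10' h11' hQ hs hsn hi hx (by omega) (by omega) hG hxw
      hw qs).execLE, ?_⟩
    refine ⟨_, by rw [show n - (j + 1) = n - j - 1 by omega], by simp [h4'], by simp; omega, ?_⟩
    simp; omega
  have hexit : ∀ st, Inv n st → (Operand.dir 10).read st.mem = 0 := by
    intro st hst
    obtain ⟨R', rfl, -, h10', -⟩ := hst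
    simp [Operand.read_dir_merge (show 10 < 100 by decide), h10']
  have h0 : Inv 0 ⟨merge R (dataMem G Q κ fun _ => []), qs⟩ := by
    refine ⟨R, ?_, h4, by simpa using h10, by simpa using h11⟩
    rw [Nat.sub_zero, List.drop_eq_nil_of_le hx.le]
    simp
  obtain ⟨st', hloop, R', rfl, h4', -, -⟩ := ExecLE.whilenz_invariant n 7 Inv hbody hexit h0
  rw [Nat.sub_self, List.drop_zero] at hloop
  exact ⟨R', hloop, h4'⟩

end boot

end SProg

/-! ## Whole runs of a bundled machine -/

namespace TM2Emu

variable (tm : FinTM2)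

/-- **The simulator of a bundled machine**: initialise the pointer table, load the input codes
(count in register `10`, end address in register `11`) on the input stack, set the codes of the
initial state and of the main label, and run the step loop. [folklore] -/
noncomputable def simProgram : SProg :=
  .seq (SProg.ptrInit (enc tm).κ) (.seq (SProg.loader (enc tm).κ ((enc tm).ι tm.k₀))
    (.seq (.block [(.add, .dir 3, .imm ((enc tm).st tm.initialState), .imm 0),
      (.add, .dir 2, .imm ((enc tm).lab tm.main), .imm 0)]) ((enc tm).simLoop tm.m)))

/-- The simulator makes no oracle query. [folklore] -/
theorem simProgram_queryFree : (simProgram tm).QueryFree :=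
  ⟨SProg.ptrInit_queryFree _, SProg.loader_queryFree _ _, SProg.block_queryFree _,
    Enc.simLoop_queryFree _ _⟩

/-- The boot cost of the simulator (pointer table, loop entry and exit, initial label). [folklore] -/
noncomputable def bootCost : ℕ := (enc tm).κ * 6 + 6

/-- The largest stack height of a run of `T` steps on an input of length `n`
(`TM2Comp.machinePushBound` pushes per step). [folklore] -/
noncomputable def heightBound (n T : ℕ) : ℕ := n + T * Complexity.TM2Comp.machinePushBound tm

/-- **Word RAMs simulate multi-stack Turing machines with constant overhead per step.** If `tm`
outputs `out` on input `inp` within `T` steps, then, started on a memory whose data part holds the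
codes of `inp` at `[s, s + |inp|)` below the base `Q` (register `4`; count and end address in
registers `10`, `11`) and is `0` from `Q` on, at any word size in which the cells of stacks of
height `heightBound |inp| T`, the symbol codes and the dispatch keys fit, `simProgram tm` reaches
the memory of the halting configuration `Turing.haltList tm out` — the output codes on the output
stack, all other stacks empty — within `bootCost + 9 |inp| + T · (stepCost + 2)` steps.
(Folklore; Papadimitriou, *Computational Complexity* (1994), §2.6; Cook–Reckhow, JCSS 7 (1973),
§2; this is the direction "Turing-machine algorithms are word-RAM algorithms" of the robustness of
exponential-time hypotheses, Vassilevska Williams, ICM 2018, §2.) [folklore] -/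
theorem simProgram_exec {inp : List (tm.Γ tm.k₀)} {out : List (tm.Γ tm.k₁)} {T : ℕ}
    (hrun : Nonempty (TM2OutputsInTime tm inp (some out) T)) {w : ℕ} {O : List ℕ → List ℕ}
    {Q s : ℕ} {R H : ℕ → ℕ} (qs : List (List ℕ)) (hQ : 100 ≤ Q) (hs : 100 ≤ s)
    (hsQ : s + inp.length ≤ Q) (h4 : R 4 = Q) (h10 : R 10 = inp.length)
    (h11 : R 11 = s + inp.length)
    (hH : ∀ t, (ht : t < inp.length) → H (s + t) = (enc tm).code tm.k₀ inp[t])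
    (hH0 : ∀ a, Q ≤ a → H a = 0)
    (hw : cellAddr Q (enc tm).κ (enc tm).κ (heightBound tm inp.length T) < 2 ^ w)
    (hγ : (enc tm).γ < 2 ^ w) (hkey : keyBound tm < 2 ^ w) :
    ∃ R' : ℕ → ℕ, SProg.ExecLE w O (simProgram tm) ⟨merge R H, qs⟩
      ⟨merge R' (dataMem H Q (enc tm).κ ((enc tm).stk (haltList tm out).stk)), qs⟩
      (bootCost tm + 9 * inp.length + T * ((enc tm).stepCost tm.m + 2)) ∧ R' 4 = Q ∧
      ∀ a ∈ out, a ∈ alphabet tm tm.k₁ := by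
  set E := enc tm with hE
  have hgood : E.Good (alphabet tm) := enc_good tm
  -- the run as a chain of configurations
  obtain ⟨⟨⟨N, hrN⟩, hsteps⟩⟩ := hrun
  obtain ⟨c, hc0, hcn, hc⟩ := chain_of_iterate_bind (f := TM2.step tm.m) N (initList tm inp)
    (haltList tm out) hrN
  replace hsteps : N ≤ T := hsteps
  -- word-size bookkeeping
  have hκ2 : Q + E.κ + E.κ < 2 ^ w := by
    refine lt_of_le_of_lt ?_ hw
    unfold cellAddr; omega
  have hκw : E.κ < 2 ^ w := by omega
  have hn : cellAddr Q E.κ E.κ inp.length < 2 ^ w :=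
    lt_of_le_of_lt (cellAddr_le_cellAddr (by unfold heightBound; omega)) hw
  have hB : ∀ l, E.lab l ≤ Fintype.card tm.Λ := lab_le tm
  have hkey' : (Fintype.card tm.Λ + 1) * E.sBase < 2 ^ w := hkey
  -- 1. pointer table
  obtain ⟨R₁, h1, hR₁⟩ := SProg.ptrInit_exec (O := O) (H := H) h4 hQ
    (fun a ha => hH0 a (by omega)) hκw hκ2 qs
  have h4₁ : R₁ 4 = Q := by rw [hR₁ 4 (by decide) (by decide) (by decide), h4]
  have h10₁ : R₁ 10 = inp.length := by rw [hR₁ 10 (by decide) (by decide) (by decide), h10]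
  have h11₁ : R₁ 11 = s + inp.length := by rw [hR₁ 11 (by decide) (by decide) (by decide), h11]
  -- 2. loader
  set x : List ℕ := inp.map (E.code tm.k₀) with hx
  have hxlen : x.length = inp.length := by simp [hx]
  have hxG : ∀ t, (ht : t < inp.length) → H (s + t) = x[t]'(hxlen ▸ ht) := by
    intro t ht; rw [hH t ht]; simp [hx]
  have hxw : ∀ c ∈ x, c < 2 ^ w := by
    intro c hc
    obtain ⟨a, -, rfl⟩ := List.mem_map.1 hc
    exact lt_of_le_of_lt (hgood.code_le _ a (mem_alphabet_k₀ tm a)) hγ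
  obtain ⟨R₂, h2, h4₂⟩ := SProg.loader_exec (O := O) (G := H) h4₁ h10₁ h11₁ hQ hs hsQ
    (hgood.ι_lt tm.k₀) hxlen hxG hxw hn qs
  have h2' : SProg.ExecLE w O (SProg.loader E.κ (E.ι tm.k₀))
      ⟨merge R₁ (dataMem H Q E.κ fun _ => []), qs⟩
      ⟨merge R₂ (dataMem H Q E.κ (E.stk (c 0).stk)), qs⟩ (inp.length * 9 + 1) := by
    rw [hc0, stk_initList]; exact h2
  -- 3. initial state and label
  have h3 := Enc.setLV_exec (O := O) (R := R₂) (H := dataMem H Q E.κ (E.stk (c 0).stk))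
    (Enc.st_lt_two_pow hgood hkey' tm.initialState) (Enc.lab_lt_two_pow hgood hB hkey' tm.main) qs
  -- 4. the loop
  have hlen0 : ∀ k, ((c 0).stk k).length + N * Complexity.TM2Comp.machinePushBound tm ≤
      heightBound tm inp.length T := by
    intro k
    rw [hc0, Complexity.TM2Comp.initList_eq]
    have h1 := Complexity.TM2Comp.length_update_bot_le tm.k₀ k inp
    have h2 := Nat.mul_le_mul_right (Complexity.TM2Comp.machinePushBound tm) hsteps
    unfold heightBound
    exact Nat.add_le_add h1 h2
  have hD : ∀ l, Complexity.TM2Comp.pushBound (tm.m l) ≤ Complexity.TM2Comp.machinePushBound tm :=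
    fun l => Finset.le_sup (f := fun l => Complexity.TM2Comp.pushBound (tm.m l)) (Finset.mem_univ l)
  obtain ⟨R₄, h4x, -, -, h4₄⟩ := Enc.simLoop_exec hgood hQ H qs hw hγ hB hkey' tm.m
    (pushesSym_alphabet tm) hD c N hc (by rw [hcn]; rfl)
    (by rw [hc0]; exact initList_mem tm inp) hlen0
    (Function.update (Function.update R₂ 3 (E.st tm.initialState)) 2 (E.lab tm.main))
    (by rw [hc0]; simp [Enc.labCode, initList]) (by rw [hc0]; simp [initList]) (by simp [h4₂])
  rw [hcn] at h4x
  have hout : ∀ a ∈ out, a ∈ alphabet tm tm.k₁ := by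
    intro a ha
    have hm := TM2Chain.chain_mem tm.m (pushesSym_alphabet tm) c N hc
      (by rw [hc0]; exact initList_mem tm inp) N le_rfl tm.k₁ a
    rw [hcn, Complexity.TM2Comp.haltList_eq] at hm
    exact hm (by simpa using ha)
  refine ⟨R₄, ?_, h4₄, hout⟩
  have hfin := h1.seq (h2'.seq (h3.execLE.seq h4x))
  refine hfin.mono ?_
  have hT : N * (E.stepCost tm.m + 2) ≤ T * (E.stepCost tm.m + 2) :=
    Nat.mul_le_mul_right _ hsteps
  show _ ≤ E.κ * 6 + 6 + 9 * inp.length + T * (E.stepCost tm.m + 2)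
  omega

end TM2Emu

end Literature.Computability.Cryptography.WordRAM
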